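import Summits.Ventures.HSemireg.WedgeHankelRecurrenceGaussZerosBounds

/-!
# Venture HSemireg — **THE SPREAD OF THE ZEROS (MIRSKY'S BOUNDS VIA POPOVICIU AND NAGY)**: for an increasing finite sequence `x_0 < ⋯ < x_n` with `S₁ = Σ x_k`, `S₂ = Σ x_k²` and
# `D = (n+1) S₂ − S₁²` (`= (n+1)²·variance`), POPOVICIU's inequality `4D ≤ (n+1)² (x_n − x_0)²` and NAGY's inequality `(n+1)(x_n − x_0)² ≤ 2D`; for the zeros of `q_{m+2}` the trace
# identities `S₁ = Σ a_i`, `S₂ = Σ a_i² + 2 Σ b_i` (N298) turn them into MIRSKY's two-sided bounds for the spread `x_{m+1} − x_0` in terms of the recurrence coefficients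

HONEST FRAMING. Part of the Lean index of the computation cell `pub-hsemireg` (seat p10 gen 44, Sunday typer «UNIFORM-IN-n»).  Finite sums of real numbers only; no variety, no cohomology theory,
no sheaf, no Ext group and no semiregularity map is constructed here; nothing here says that HC / HC_CM / HC_AV holds; no Literature fact (unproved `Prop`) is declared or used.  Custodian versions
as in `WedgeHankelSiegelIdeal` (1/3).
SOURCES (cited).  T. Popoviciu, *Sur les équations algébriques ayant toutes leurs racines réelles*, Mathematica (Cluj) 9 (1935) 129–145; J. v. Sz. Nagy, *Über algebraische Gleichungen mit lauter
reellen Wurzeln*, Jahresber. DMV 27 (1918) 37–43; L. Mirsky, *The spread of a matrix*, Mathematika 3 (1956) 127–130 (`2√(tr A²∕n − (tr A∕n)²) ≤ spread ≤ √(2 tr A² − 2(tr A)²∕n)` for Hermitian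
`A`); R. Bhatia, C. Davis, *A better bound on the variance*, Amer. Math. Monthly 107 (2000) 353–357.
PROOF TYPED HERE.  Popoviciu: `(x_k − x_0)(x_n − x_k) ≥ 0` summed, then a square completes; Nagy: `Σ ((n+1)x_k − S₁)² = (n+1)D` and the two extreme terms alone give `((n+1)(x_n − x_0))²∕2`;
the zeros by N298 `sum_recurrence_zeros`, `sum_recurrence_zeros_sq`.
DEDUP DISCLOSURE (`rg -n -i 'popoviciu|mirsky|spread|nagy' Summits Literature`, 2026-09-03): the tree has the Laguerre–Samuelson bound for the zeros (N312, `Literature…LaguerreRootBound`), which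
bounds EACH zero by the same two sums; the spread bounds are new.  The 5 names below: 0 hits tree-wide.

WHAT IS IN THE TREE.  N298 `sum_recurrence_zeros`, `sum_recurrence_zeros_sq`.
THIS FILE (namespace `Summit.Ventures.HSemireg.Wedge.HankelOuter` continued; CHAINED on N329 (import only); 0 definitions):
* §1095 **`popoviciu_spread`** (`4((n+1)S₂ − S₁²) ≤ (n+1)²(x_n − x_0)²`), `sum_sq_scaled_dev_eq` (`Σ ((n+1)x_k − S₁)² = (n+1)((n+1)S₂ − S₁²)`), **`nagy_spread`** (`(n+1)(x_n − x_0)² ≤ 2((n+1)S₂ − S₁²)`,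
  `n ≥ 1`), **`zeros_spread_lower`** (`4 D ≤ (m+2)² (x_{m+1} − x_0)²`, `D = (m+2)(Σa² + 2Σb) − (Σa)²`), **`zeros_spread_upper`** (`(m+2)(x_{m+1} − x_0)² ≤ 2D`).
CAVEATS.  Real monic recurrences with the zeros of `q_{m+2}` given as an increasing vector (no positivity of `b` is needed for the identities, only for the existence of such zeros).  Nothing
Ext-side.  New names only.
-/

open Module Polynomial
open scoped Matrix Polynomial

namespace Summit.Ventures.HSemireg.Wedge.HankelOuter

/-! ## §1095. The spread of the zeros -/

/-- **POPOVICIU'S INEQUALITY (spread form): `4((n+1)Σx² − (Σx)²) ≤ (n+1)²(x_n − x_0)²` for `x_0 ≤ x_k ≤ x_n`.** [Popoviciu 1935; Bhatia–Davis 2000; this file, §1095] -/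
theorem popoviciu_spread {n : ℕ} {x : Fin (n + 1) → ℝ} (hx : Monotone x) :
    4 * (((n : ℝ) + 1) * ∑ k, x k ^ 2 - (∑ k, x k) ^ 2) ≤ ((n : ℝ) + 1) ^ 2 * (x (Fin.last n) - x 0) ^ 2 := by
  have hk : ∀ k, x k ^ 2 ≤ (x 0 + x (Fin.last n)) * x k - x 0 * x (Fin.last n) := fun k => by
    nlinarith [mul_nonneg (sub_nonneg.2 (hx (Fin.zero_le k))) (sub_nonneg.2 (hx (Fin.le_last k)))]
  have hsum : ∑ k, x k ^ 2 ≤ (x 0 + x (Fin.last n)) * ∑ k, x k - ((n : ℝ) + 1) * (x 0 * x (Fin.last n)) := by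
    have h := Finset.sum_le_sum fun k (_ : k ∈ Finset.univ) => hk k
    rw [Finset.sum_sub_distrib, ← Finset.mul_sum, Finset.sum_const, Finset.card_univ, Fintype.card_fin, nsmul_eq_mul, Nat.cast_add, Nat.cast_one] at h
    exact h
  nlinarith [hsum, sq_nonneg (((n : ℝ) + 1) * (x 0 + x (Fin.last n)) - 2 * ∑ k, x k)]

/-- **`Σ_k ((n+1)x_k − S₁)² = (n+1)((n+1)S₂ − S₁²)`** (`(n+1)²` times the variance identity). [this file, §1095] -/
theorem sum_sq_scaled_dev_eq {n : ℕ} (x : Fin (n + 1) → ℝ) :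
    ∑ k, (((n : ℝ) + 1) * x k - ∑ j, x j) ^ 2 = ((n : ℝ) + 1) * (((n : ℝ) + 1) * ∑ k, x k ^ 2 - (∑ k, x k) ^ 2) := by
  have hl : ∀ k, (((n : ℝ) + 1) * x k - ∑ j, x j) ^ 2 = ((n : ℝ) + 1) ^ 2 * x k ^ 2 - 2 * (((n : ℝ) + 1) * ∑ j, x j) * x k + (∑ j, x j) ^ 2 := fun k => by ring
  rw [Finset.sum_congr rfl fun k _ => hl k, Finset.sum_add_distrib, Finset.sum_sub_distrib, ← Finset.mul_sum, ← Finset.mul_sum, Finset.sum_const, Finset.card_univ, Fintype.card_fin,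
    nsmul_eq_mul, Nat.cast_add, Nat.cast_one]
  ring

/-- **NAGY'S INEQUALITY (spread form): `(n+1)(x_n − x_0)² ≤ 2((n+1)Σx² − (Σx)²)` for `n ≥ 1`.** [v. Sz. Nagy 1918; this file, §1095] -/
theorem nagy_spread {n : ℕ} (hn : 1 ≤ n) (x : Fin (n + 1) → ℝ) :
    ((n : ℝ) + 1) * (x (Fin.last n) - x 0) ^ 2 ≤ 2 * (((n : ℝ) + 1) * ∑ k, x k ^ 2 - (∑ k, x k) ^ 2) := by
  have hne : (0 : Fin (n + 1)) ≠ Fin.last n := fun h => by have := congrArg Fin.val h; simp at this; omega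
  have htwo : (((n : ℝ) + 1) * x 0 - ∑ j, x j) ^ 2 + (((n : ℝ) + 1) * x (Fin.last n) - ∑ j, x j) ^ 2 ≤ ∑ k, (((n : ℝ) + 1) * x k - ∑ j, x j) ^ 2 := by
    have h := Finset.sum_le_sum_of_subset_of_nonneg (f := fun k => (((n : ℝ) + 1) * x k - ∑ j, x j) ^ 2) (Finset.subset_univ ({0, Fin.last n} : Finset (Fin (n + 1))))
      fun k _ _ => sq_nonneg _
    rwa [Finset.sum_pair hne] at h
  rw [sum_sq_scaled_dev_eq] at htwo
  have hpos : (0 : ℝ) < (n : ℝ) + 1 := by positivity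
  nlinarith [htwo, sq_nonneg (((n : ℝ) + 1) * x 0 - ∑ j, x j + (((n : ℝ) + 1) * x (Fin.last n) - ∑ j, x j))]

/-- **MIRSKY'S LOWER BOUND FOR THE SPREAD OF THE ZEROS: `4D ≤ (m+2)² (x_{m+1} − x_0)²` with `D = (m+2)(Σ_{i≤m+1} a_i² + 2Σ_{i≤m} b_{i+1}) − (Σ_{i≤m+1} a_i)²`** for the increasing zeros `x` of `q_{m+2}`.
[Mirsky 1956; Popoviciu 1935; this file, §1095] -/
theorem zeros_spread_lower {q : ℕ → ℝ[X]} {a b : ℕ → ℝ} (hq0 : q 0 = 1) (hq1 : q 1 = Polynomial.X - C (a 0))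
    (hrec : ∀ n, q (n + 2) = (Polynomial.X - C (a (n + 1))) * q (n + 1) - C (b (n + 1)) * q n)
    {m : ℕ} {x : Fin (m + 2) → ℝ} (hx : StrictMono x) (hxq : q (m + 2) = ∏ k, (Polynomial.X - C (x k))) :
    4 * (((m : ℝ) + 2) * (∑ i ∈ Finset.range (m + 2), a i ^ 2 + 2 * ∑ i ∈ Finset.range (m + 1), b (i + 1)) - (∑ i ∈ Finset.range (m + 2), a i) ^ 2) ≤
      ((m : ℝ) + 2) ^ 2 * (x (Fin.last (m + 1)) - x 0) ^ 2 := by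
  have h := popoviciu_spread hx.monotone
  rw [sum_recurrence_zeros hq0 hq1 hrec hxq, sum_recurrence_zeros_sq hq0 hq1 hrec hxq, Nat.cast_add, Nat.cast_one] at h
  have e : ((m : ℝ) + 1 + 1) = (m : ℝ) + 2 := by ring
  rw [e] at h
  exact h

/-- **MIRSKY'S UPPER BOUND FOR THE SPREAD OF THE ZEROS: `(m+2)(x_{m+1} − x_0)² ≤ 2D`.** [Mirsky 1956; v. Sz. Nagy 1918; this file, §1095] -/
theorem zeros_spread_upper {q : ℕ → ℝ[X]} {a b : ℕ → ℝ} (hq0 : q 0 = 1) (hq1 : q 1 = Polynomial.X - C (a 0))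
    (hrec : ∀ n, q (n + 2) = (Polynomial.X - C (a (n + 1))) * q (n + 1) - C (b (n + 1)) * q n)
    {m : ℕ} {x : Fin (m + 2) → ℝ} (hxq : q (m + 2) = ∏ k, (Polynomial.X - C (x k))) :
    ((m : ℝ) + 2) * (x (Fin.last (m + 1)) - x 0) ^ 2 ≤
      2 * (((m : ℝ) + 2) * (∑ i ∈ Finset.range (m + 2), a i ^ 2 + 2 * ∑ i ∈ Finset.range (m + 1), b (i + 1)) - (∑ i ∈ Finset.range (m + 2), a i) ^ 2) := by
  have h := nagy_spread (by omega : 1 ≤ m + 1) x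
  rw [sum_recurrence_zeros hq0 hq1 hrec hxq, sum_recurrence_zeros_sq hq0 hq1 hrec hxq, Nat.cast_add, Nat.cast_one] at h
  have e : ((m : ℝ) + 1 + 1) = (m : ℝ) + 2 := by ring
  rw [e] at h
  exact h

end Summit.Ventures.HSemireg.Wedge.HankelOuter
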